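import Summits.CriticalPhenomena.PercolationContinuityZ3.Theorems.PercNearOneGluingNoHeavyLowerTailStarSetLinkRepresentation
import Literature.Probability.Percolation.LonelyClusterExchange
import HarnessLib

/-!
# `NoHeavyLowerTail` (stmt-CriticalPhenomena-4575) — the GLUED graph of a two-port star family and the RELAY-SET ROWS in link form

Support file (prover `prim-gen-swap` gen 7; `--supports stmt-CriticalPhenomena-4575`).  No definitions, no named facts, no sorries.

Setting as in `…StarSetLinkRepresentation`: stars `s i` (pairwise distinct, off `A`) with ports `p i ≠ p' i`, port pairs of weights
`β_i, β_i'`, `θ_i = β_iβ_i'`, no other positive pair at a star; `ξ(ω)` = the configuration off the stars, `L_σ` = the links of the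
stars in the pattern `σ`, pattern weight `w(σ) = Π_{i∈σ}θ_i Π_{i∉σ}(1−θ_i)`.

* `StarSet.linkInvariant_sepSmall / _sepLonely / _lightness` — the three event shapes of the observer-set inequality read only the
  reachability relation off the stars (admissibility for the link representation).
* `StarSet.exists_gluedWeights` — the GLUED graph `w_G`: star `i` surely attached to `p i`, its second pair of weight `θ_i`, everything
  else as in `w`; it has the link probabilities of `w`.
* `StarSet.lightness_eq_linkSum` — `μ_w{|π(x)| ≤ j} = Σ_σ w(σ) μ_w{|π_{ξ∪L_σ}(x)| ≤ j}` for `x` off the stars.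
* `StarSet.linkRow_le` — **relay-set rows in link form**: for a vertex set `R` off the stars containing a vertex `y` with
  `μ_w{|π(y)| ≤ j} ≤ μ_w{|π(c)| ≤ j}`,
  `Σ_σ w(σ) μ_w(c ↮_{ξ∪L_σ} R, 1 ≤ |π_{ξ∪L_σ}(R)| ≤ j) ≤ Σ_σ w(σ) μ_w(c ↮_{ξ∪L_σ} R, |π_{ξ∪L_σ}(c)| ≤ j)`:
  both sides are the two events of `CS_{w_G}(R, c)` (link representation in the glued graph), the lightnesses of `y` and `c` are the
  same in `w_G` as in `w` (`real_reachFunctional_eq_of_sameLinks`), and `CS_{w_G}(R, c)` is van den Berg–Häggström–Kahn's observer-set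
  transfer `observerSet_le_of_lonelier`.  This is step (2) ("glued terms dominate relay-set rows, which are nonnegative") of the
  level-two observer-set theorem for two-port star sets (seat memo R3-SEATS.md §7), integrated.
-/

noncomputable section

namespace Summit.CriticalPhenomena.PercolationContinuityZ3.Theorems

open MeasureTheory Set Literature.Probability.LatticeModels Literature.Probability.Percolation
open scoped Classical BigOperators

variable {n m : ℕ}

namespace StarSet

/-- The ρ-event `c ↮ R ∧ |π(c)| ≤ j` reads only the reachability relation off the stars (`c`, `R`, `A` off the stars). [folklore] -/
theorem linkInvariant_sepSmall (s : Fin m → Fin n) (A R : Finset (Fin n)) (c : Fin n) (j : ℕ)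
    (hsA : ∀ i, s i ∉ A) (hRs : ∀ u ∈ R, ∀ i, u ≠ s i) (hcs : ∀ i, c ≠ s i) :
    ∀ Q Q' : Fin n → Fin n → Prop, (∀ a b, (∀ i, a ≠ s i) → (∀ i, b ≠ s i) → (Q a b ↔ Q' a b)) →
      (((∀ u ∈ R, ¬ Q c u) ∧ (A.filter fun z => Q c z).card ≤ j) ↔
        ((∀ u ∈ R, ¬ Q' c u) ∧ (A.filter fun z => Q' c z).card ≤ j)) := by
  intro Q Q' hQ
  have hfilt : (A.filter fun z => Q c z) = A.filter fun z => Q' c z :=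
    Finset.filter_congr fun z hz => hQ c z hcs (fun i h => hsA i (h ▸ hz))
  rw [hfilt]
  exact and_congr_left fun _ => forall₂_congr fun u hu => not_congr (hQ c u hcs (hRs u hu))

/-- The ℓ-event `c ↮ R ∧ 1 ≤ |π(R)| ≤ j` reads only the reachability relation off the stars. [folklore] -/
theorem linkInvariant_sepLonely (s : Fin m → Fin n) (A R : Finset (Fin n)) (c : Fin n) (j : ℕ)
    (hsA : ∀ i, s i ∉ A) (hRs : ∀ u ∈ R, ∀ i, u ≠ s i) (hcs : ∀ i, c ≠ s i) :
    ∀ Q Q' : Fin n → Fin n → Prop, (∀ a b, (∀ i, a ≠ s i) → (∀ i, b ≠ s i) → (Q a b ↔ Q' a b)) →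
      (((∀ u ∈ R, ¬ Q c u) ∧ 1 ≤ (A.filter fun z => ∃ u ∈ R, Q u z).card ∧ (A.filter fun z => ∃ u ∈ R, Q u z).card ≤ j) ↔
        ((∀ u ∈ R, ¬ Q' c u) ∧ 1 ≤ (A.filter fun z => ∃ u ∈ R, Q' u z).card ∧
          (A.filter fun z => ∃ u ∈ R, Q' u z).card ≤ j)) := by
  intro Q Q' hQ
  have hfilt : (A.filter fun z => ∃ u ∈ R, Q u z) = A.filter fun z => ∃ u ∈ R, Q' u z :=
    Finset.filter_congr fun z hz => exists_congr fun u => and_congr_right fun hu => hQ u z (hRs u hu) (fun i h => hsA i (h ▸ hz))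
  rw [hfilt]
  exact and_congr_left fun _ => forall₂_congr fun u hu => not_congr (hQ c u hcs (hRs u hu))

/-- The lightness event `|π(x)| ≤ j` of a vertex `x` off the stars reads only the reachability relation off the stars. [folklore] -/
theorem linkInvariant_lightness (s : Fin m → Fin n) (A : Finset (Fin n)) (x : Fin n) (j : ℕ)
    (hsA : ∀ i, s i ∉ A) (hxs : ∀ i, x ≠ s i) :
    ∀ Q Q' : Fin n → Fin n → Prop, (∀ a b, (∀ i, a ≠ s i) → (∀ i, b ≠ s i) → (Q a b ↔ Q' a b)) →
      ((A.filter fun z => Q x z).card ≤ j ↔ (A.filter fun z => Q' x z).card ≤ j) := by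
  intro Q Q' hQ
  have hfilt : (A.filter fun z => Q x z) = A.filter fun z => Q' x z :=
    Finset.filter_congr fun z hz => hQ x z hxs (fun i h => hsA i (h ▸ hz))
  rw [hfilt]

/-- **The glued graph.**  There is a weight function `w_G` with `w_G(s(s i, p i)) = 1`, `w_G(s(s i, p' i)) = β_iβ_i'`, no other
positive pair at a star, and `w_G = w` off the stars. [folklore] -/
theorem exists_gluedWeights (w : Sym2 (Fin n) → unitInterval) (s p p' : Fin m → Fin n)
    (hs : Function.Injective s) (hps : ∀ i k, p i ≠ s k) (hp's : ∀ i k, p' i ≠ s k) (hpp' : ∀ i, p i ≠ p' i)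
    (hwjunk : ∀ i u, u ≠ s i → u ≠ p i → u ≠ p' i → w s(s i, u) = 0) :
    ∃ W : Sym2 (Fin n) → unitInterval,
      (∀ i, W s(s i, p i) = 1) ∧ (∀ i, (W s(s i, p' i) : ℝ) = (w s(s i, p i) : ℝ) * w s(s i, p' i)) ∧
      (∀ i u, u ≠ s i → u ≠ p i → u ≠ p' i → W s(s i, u) = 0) ∧ (∀ e : Sym2 (Fin n), (∀ i, s i ∉ e) → W e = w e) := by
  -- which pairs are first / second port pairs
  have first_iff : ∀ (i : Fin m) (u : Fin n), (∃ k, (s(s i, u) : Sym2 (Fin n)) = s(s k, p k)) ↔ u = p i := by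
    intro i u
    constructor
    · rintro ⟨k, hk⟩
      rcases Sym2.eq_iff.1 hk with ⟨h1, h2⟩ | ⟨h1, _⟩
      · rw [hs h1]; exact h2
      · exact absurd h1.symm (hps k i)
    · rintro rfl; exact ⟨i, rfl⟩
  have second_iff : ∀ (i : Fin m) (u : Fin n), (∃ k, (s(s i, u) : Sym2 (Fin n)) = s(s k, p' k)) ↔ u = p' i := by
    intro i u
    constructor
    · rintro ⟨k, hk⟩
      rcases Sym2.eq_iff.1 hk with ⟨h1, h2⟩ | ⟨h1, _⟩
      · rw [hs h1]; exact h2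
      · exact absurd h1.symm (hp's k i)
    · rintro rfl; exact ⟨i, rfl⟩
  refine ⟨fun e => if (∃ k, e = s(s k, p k)) then 1 else
    if h : (∃ k, e = s(s k, p' k)) then
      ⟨(w s(s h.choose, p h.choose) : ℝ) * w e, unitInterval.mul_mem (w _).2 (w _).2⟩ else w e, ?_, ?_, ?_, ?_⟩
  · intro i
    simp only
    rw [if_pos ⟨i, rfl⟩]
  · intro i
    have h1 : ¬ ∃ k, (s(s i, p' i) : Sym2 (Fin n)) = s(s k, p k) := fun h => hpp' i ((first_iff i _).1 h).symm
    have h2 : ∃ k, (s(s i, p' i) : Sym2 (Fin n)) = s(s k, p' k) := ⟨i, rfl⟩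
    simp only
    rw [if_neg h1, dif_pos h2]
    have hk : h2.choose = i := by
      have hspec := h2.choose_spec
      rcases Sym2.eq_iff.1 hspec with ⟨h3, _⟩ | ⟨h3, _⟩
      · exact (hs h3).symm
      · exact absurd h3.symm (hp's _ i)
    simp only [hk]
  · intro i u hu hup hup'
    have h1 : ¬ ∃ k, (s(s i, u) : Sym2 (Fin n)) = s(s k, p k) := fun h => hup ((first_iff i u).1 h)
    have h2 : ¬ ∃ k, (s(s i, u) : Sym2 (Fin n)) = s(s k, p' k) := fun h => hup' ((second_iff i u).1 h)
    simp only
    rw [if_neg h1, dif_neg h2]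
    exact hwjunk i u hu hup hup'
  · intro e he
    have h1 : ¬ ∃ k, e = s(s k, p k) := fun ⟨k, hk⟩ => he k (hk ▸ Sym2.mem_mk_left _ _)
    have h2 : ¬ ∃ k, e = s(s k, p' k) := fun ⟨k, hk⟩ => he k (hk ▸ Sym2.mem_mk_left _ _)
    simp only
    rw [if_neg h1, dif_neg h2]

/-- **Lightness as a link sum.**  For `x` off the stars (relays off the stars):
`μ_w{|π(x)| ≤ j} = Σ_σ w(σ) · μ_w{|π_{ξ(ω)∪L_σ}(x)| ≤ j}`. [folklore] -/
theorem lightness_eq_linkSum (w : Sym2 (Fin n) → unitInterval) (A : Finset (Fin n)) (s p p' : Fin m → Fin n) (x : Fin n)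
    (j : ℕ) (hs : Function.Injective s) (hps : ∀ i k, p i ≠ s k) (hp's : ∀ i k, p' i ≠ s k) (hpp' : ∀ i, p i ≠ p' i)
    (hwjunk : ∀ i u, u ≠ s i → u ≠ p i → u ≠ p' i → w s(s i, u) = 0)
    (hsA : ∀ i, s i ∉ A) (hxs : ∀ i, x ≠ s i) :
    (prodBernoulli w).real {ω : BondConfig (Fin n) | (A.filter fun z => (openGraph ω).Reachable x z).card ≤ j} =
      ∑ σ ∈ (Finset.univ : Finset (Fin m)).powerset,
        ((∏ i ∈ σ, ((w s(s i, p i) : ℝ) * w s(s i, p' i))) *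
            ∏ i ∈ Finset.univ \ σ, (1 - (w s(s i, p i) : ℝ) * w s(s i, p' i))) *
          (prodBernoulli w).real {ω : BondConfig (Fin n) |
            (A.filter fun z => (openGraph ((ω ∩ {e | ∀ v ∈ Finset.univ.image s, v ∉ e}) ∪
              ↑(σ.image fun i => (s(p i, p' i) : Sym2 (Fin n))))).Reachable x z).card ≤ j} := by
  have h := real_reachFunctional_eq_linkSum w w s p p' hs hps hp's hpp' hwjunk (fun _ _ => rfl)
    (fun Q => (A.filter fun z => Q x z).card ≤ j) (linkInvariant_lightness s A x j hsA hxs)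
  beta_reduce at h
  convert h using 12

/-- **Relay-set rows in link form.**  If `R` (off the stars) contains a vertex `y` with `μ_w{|π(y)| ≤ j} ≤ μ_w{|π(c)| ≤ j}` (`c` off the
stars, relays off the stars), then
`Σ_σ w(σ) μ_w(c ↮_{ξ∪L_σ} R, 1 ≤ |π_{ξ∪L_σ}(R)| ≤ j) ≤ Σ_σ w(σ) μ_w(c ↮_{ξ∪L_σ} R, |π_{ξ∪L_σ}(c)| ≤ j)`.
[cite: VandenbergHaggstromKahn2005, Thm. 1.5 (p. 7) — via `observerSet_le_of_lonelier` in the glued graph] -/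
theorem linkRow_le (w : Sym2 (Fin n) → unitInterval) (A : Finset (Fin n)) (s p p' : Fin m → Fin n) (R : Finset (Fin n))
    (y c : Fin n) (j : ℕ) (hs : Function.Injective s) (hps : ∀ i k, p i ≠ s k) (hp's : ∀ i k, p' i ≠ s k)
    (hpp' : ∀ i, p i ≠ p' i) (hwjunk : ∀ i u, u ≠ s i → u ≠ p i → u ≠ p' i → w s(s i, u) = 0)
    (hsA : ∀ i, s i ∉ A) (hRs : ∀ u ∈ R, ∀ i, u ≠ s i) (hcs : ∀ i, c ≠ s i) (hy : y ∈ R)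
    (hle : (prodBernoulli w).real {ω : BondConfig (Fin n) | (A.filter fun z => ω ∈ openConn y z).card ≤ j} ≤
      (prodBernoulli w).real {ω : BondConfig (Fin n) | (A.filter fun z => ω ∈ openConn c z).card ≤ j}) :
    ∑ σ ∈ (Finset.univ : Finset (Fin m)).powerset,
        ((∏ i ∈ σ, ((w s(s i, p i) : ℝ) * w s(s i, p' i))) *
            ∏ i ∈ Finset.univ \ σ, (1 - (w s(s i, p i) : ℝ) * w s(s i, p' i))) *
          (prodBernoulli w).real {ω : BondConfig (Fin n) |
            (∀ u ∈ R, ¬ (openGraph ((ω ∩ {e | ∀ v ∈ Finset.univ.image s, v ∉ e}) ∪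
              ↑(σ.image fun i => (s(p i, p' i) : Sym2 (Fin n))))).Reachable c u) ∧
            1 ≤ (A.filter fun z => ∃ u ∈ R, (openGraph ((ω ∩ {e | ∀ v ∈ Finset.univ.image s, v ∉ e}) ∪
              ↑(σ.image fun i => (s(p i, p' i) : Sym2 (Fin n))))).Reachable u z).card ∧
            (A.filter fun z => ∃ u ∈ R, (openGraph ((ω ∩ {e | ∀ v ∈ Finset.univ.image s, v ∉ e}) ∪
              ↑(σ.image fun i => (s(p i, p' i) : Sym2 (Fin n))))).Reachable u z).card ≤ j} ≤
      ∑ σ ∈ (Finset.univ : Finset (Fin m)).powerset,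
        ((∏ i ∈ σ, ((w s(s i, p i) : ℝ) * w s(s i, p' i))) *
            ∏ i ∈ Finset.univ \ σ, (1 - (w s(s i, p i) : ℝ) * w s(s i, p' i))) *
          (prodBernoulli w).real {ω : BondConfig (Fin n) |
            (∀ u ∈ R, ¬ (openGraph ((ω ∩ {e | ∀ v ∈ Finset.univ.image s, v ∉ e}) ∪
              ↑(σ.image fun i => (s(p i, p' i) : Sym2 (Fin n))))).Reachable c u) ∧
            (A.filter fun z => (openGraph ((ω ∩ {e | ∀ v ∈ Finset.univ.image s, v ∉ e}) ∪
              ↑(σ.image fun i => (s(p i, p' i) : Sym2 (Fin n))))).Reachable c z).card ≤ j} := by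
  obtain ⟨W, hW1, hW2, hWjunk, hWoff⟩ := exists_gluedWeights w s p p' hs hps hp's hpp' hwjunk
  have hθ : ∀ i, (W s(s i, p i) : ℝ) * W s(s i, p' i) = (w s(s i, p i) : ℝ) * w s(s i, p' i) := by
    intro i
    rw [hW1, hW2]
    simp
  -- the two sides are the two events of `CS_W(R, c)`
  have hL := real_reachFunctional_eq_linkSum W w s p p' hs hps hp's hpp' hWjunk hWoff
    (fun Q => (∀ u ∈ R, ¬ Q c u) ∧ 1 ≤ (A.filter fun z => ∃ u ∈ R, Q u z).card ∧ (A.filter fun z => ∃ u ∈ R, Q u z).card ≤ j)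
    (linkInvariant_sepLonely s A R c j hsA hRs hcs)
  have hR := real_reachFunctional_eq_linkSum W w s p p' hs hps hp's hpp' hWjunk hWoff
    (fun Q => (∀ u ∈ R, ¬ Q c u) ∧ (A.filter fun z => Q c z).card ≤ j)
    (linkInvariant_sepSmall s A R c j hsA hRs hcs)
  simp only [hθ] at hL hR
  rw [← hL, ← hR]
  -- the lightnesses of `y` and `c` are the same in `W` as in `w`
  have hy' : ∀ i, y ≠ s i := hRs y hy
  have hIy := real_reachFunctional_eq_of_sameLinks W w w s p p' hs hps hp's hpp' hWjunk hWoff hwjunk (fun _ _ => rfl) hθ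
    (fun Q => (A.filter fun z => Q y z).card ≤ j) (linkInvariant_lightness s A y j hsA hy')
  have hIc := real_reachFunctional_eq_of_sameLinks W w w s p p' hs hps hp's hpp' hWjunk hWoff hwjunk (fun _ _ => rfl) hθ
    (fun Q => (A.filter fun z => Q c z).card ≤ j) (linkInvariant_lightness s A c j hsA hcs)
  have hle' : (prodBernoulli W).real {ω : BondConfig (Fin n) | (A.filter fun z => ω ∈ openConn y z).card ≤ j} ≤
      (prodBernoulli W).real {ω : BondConfig (Fin n) | (A.filter fun z => ω ∈ openConn c z).card ≤ j} := by
    have h1 : (prodBernoulli W).real {ω : BondConfig (Fin n) | (A.filter fun z => ω ∈ openConn y z).card ≤ j} =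
        (prodBernoulli w).real {ω : BondConfig (Fin n) | (A.filter fun z => ω ∈ openConn y z).card ≤ j} := hIy
    have h2 : (prodBernoulli W).real {ω : BondConfig (Fin n) | (A.filter fun z => ω ∈ openConn c z).card ≤ j} =
        (prodBernoulli w).real {ω : BondConfig (Fin n) | (A.filter fun z => ω ∈ openConn c z).card ≤ j} := hIc
    rw [h1, h2]; exact hle
  simpa only [openConn, Set.mem_setOf_eq] using observerSet_le_of_lonelier W A R y c hy j hle'

end StarSet

end Summit.CriticalPhenomena.PercolationContinuityZ3.Theorems

end
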